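import Summits.BirchSwinnertonDyer.BirchSwinnertonDyer.Theorems.UniversalToricDescentWildSplitControlAtThreeOfFacts
import Summits.BirchSwinnertonDyer.BirchSwinnertonDyer.Theorems.PotentiallySupersingularLocalTowerTorsionFinite
import HarnessLib

/-!
# Route `UniversalToricDescent`, crux #5 `WildSplitControlAtThree` (item stmt-BirchSwinnertonDyer-20386)
# modulo PUBLISHED FACTS ONLY: the last input — local irreducibility at the wild prime — is
# Serre 1967, §5 Prop. 8

Seat `bsd-potss-kmc`, gen 17 (cell `bsd-potss`; service on bsd-wall-pss3's route `UniversalToricDescent`,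
whose leaf `WAllExclAddWildRankOne` is the content of this seat's residual K9 19200 `WildRankOne`).
Thin BY-NAME closer in the route's import cone; all mathematics is in the route-free module
`Theorems/PotentiallySupersingularLocalTowerTorsionFinite.lean` (`localTowerTorsionFiniteClaim_three_of_classO6`
= Fin_v on the whole wild class O6 modulo the cite-level named fact
`Literature.NumberTheory.EllipticCurves.Serre1967.noStableDivisibleLine_of_potentiallySupersingular` =
Serre 1967 §5 Prop. 8 in the tree's vocabulary) and
in gen 16's `Theorems/UniversalToricDescentWildSplitControlAtThreeOfFacts.lean`
(`wildSplitControlAtThree_of_facts` = the K1 door on the cell modulo five cited facts + Brink Cor 1 +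
Fin_v on the `t₃ ≥ 1` rows).

* **`wildSplitControlAtThree_of_facts_of_serre1967`** — crux #5 BY NAME
  (`Theses.UniversalToricDescent.WildSplitControlAtThree`) from EIGHT PUBLISHED FACTS: the five of the K1
  door (Poitou–Tate duality for Selmer structures and for `Ш`, local Euler–Poincaré characteristic,
  `cd ≤ 2` for number fields, Brink Thm 2), Brink Cor 1, and Serre 1967 §5 Prop. 8. So the crux is
  PRINT-LEVEL: what remains for the item is the discharge (or item-statement by its planner) of named
  published facts, not mathematics at the wild prime.

CONDITIONAL (named-fact hypotheses); closes nothing by itself; BSD is not proved by any of this; no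
statement of route `UniversalToricDescent` is altered.

References: [Serre1967GroupesPDivisibles] §5 Prop. 8; [JetchevSkinnerWan2017] Thm. 3.3.1, Prop. 3.3.4;
[MilneADT2006] I 2.8, 4.10; [Brink2007] Thm. 2, Cor. 1; [Kolyvagin1990] Thm. A; [GrossLMS1991] §2.
-/

noncomputable section

open scoped Classical

open WeierstrassCurve NumberField IsDedekindDomain Field Literature.NumberTheory.EllipticCurves
  Literature.NumberTheory.EllipticCurves.GreenbergSelmer
  Literature.NumberTheory.GaloisRepresentations
  Literature.NumberTheory.GaloisCohomology
  Literature.NumberTheory.EllipticCurves.Rank1Residual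
  Summit.BirchSwinnertonDyer.Rank1Residual.Additive
  Summit.BirchSwinnertonDyer.BirchSwinnertonDyer.Theorems.PotentiallySupersingularLocalTorsion

set_option linter.dupNamespace false

namespace Summit.BirchSwinnertonDyer.BirchSwinnertonDyer.Theorems.UniversalToricDescentControl

/-- **Crux #5 of route `UniversalToricDescent` BY NAME (`Theses.UniversalToricDescent.WildSplitControlAtThree`,
item stmt-BirchSwinnertonDyer-20386) from EIGHT PUBLISHED FACTS**: the five cited facts of the K1 door
(Poitou–Tate duality for Selmer structures and for `Ш`, the local Euler–Poincaré characteristic,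
`cd_p ≤ 2` for number fields, Brink Thm 2), Brink Cor 1, and Serre 1967 §5 Prop. 8 (local irreducibility
at the wild potentially supersingular `3`, through
`PotentiallySupersingularLocalTorsion.localTowerTorsionFiniteClaim_three_of_classO6`). Composition: gen 16's
`wildSplitControlAtThree_of_facts` with its Fin_v hypothesis supplied on every cell curve. CONDITIONAL
(named-fact hypotheses); closes nothing by itself; BSD is not proved by any of this.
[cite: JetchevSkinnerWan2017, Thm. 3.3.1, Prop. 3.3.4 (arXiv:1512.06894 pp. 11–13)]
[cite: MilneADT2006, Ch. I, Thm. 4.10 and Thm. 2.8] [cite: Brink2007, Thm. 2 and Cor. 1]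
[cite: Serre1967GroupesPDivisibles, §5 Prop. 8] [cite: Kolyvagin1990, Thm. A] [cite: GrossLMS1991, §2] -/
theorem wildSplitControlAtThree_of_facts_of_serre1967
    (hPT : ∀ (K : Type) [Field K] [NumberField K], poitouTate_selmerStructure_duality K)
    (hPT2 : ∀ (K : Type) [Field K] [NumberField K], poitouTate_sha_tateDual K)
    (hEP : ∀ (K : Type) [Field K] [NumberField K] (v : HeightOneSpectrum (𝓞 K)),
      localEulerPoincareCharacteristic (v.adicCompletion K))
    (hcd : fieldCdLE_two_of_numberField)
    (hBr : ∀ (K : Type) [Field K] [NumberField K] (p : ℕ) [Fact p.Prime],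
      ZpExtension.decomp_not_le_kerSubgroup_of_isAnticyclotomic K p)
    (hBr2 : ∀ (K : Type) [Field K] [NumberField K] (p : ℕ) [Fact p.Prime],
      ZpExtension.decomp_not_le_kerSubgroup_above_of_isAnticyclotomic K p)
    (hS : Serre1967.noStableDivisibleLine_of_potentiallySupersingular) :
    Summit.BirchSwinnertonDyer.BirchSwinnertonDyer.Theses.UniversalToricDescent.WildSplitControlAtThree :=
  wildSplitControlAtThree_of_facts hPT hPT2 hEP hcd hBr hBr2
    fun W _ _ hO6 _ _ _ ↦ localTowerTorsionFiniteClaim_three_of_classO6 hS W hO6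

end Summit.BirchSwinnertonDyer.BirchSwinnertonDyer.Theorems.UniversalToricDescentControl

end
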